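/-
Copyright: statement-level skeleton of a published paper (lit-balaban cell, Phase-2 proof seat p37 gen 105). No claims beyond
what the kernel checks below.
-/
import Literature.MathematicalPhysics.QuantumFieldTheory.Balaban1983to89.B3OnePIGraphs
import Literature.MathematicalPhysics.QuantumFieldTheory.Balaban1983to89.B3Sect2ThreeLegGraphs

/-!
# B3 — T. Bałaban, *(Higgs)₂,₃ quantum fields in a finite volume. III. Renormalization*, CMP **88** (1983) 411–445
[Balaban1983Higgs3] — p. 430 [PDF 20] *"We consider one-particle-irreducible graphs only"*, p. 438 [PDF 28] *"There are only two
such graphs: (3.21)"*: the CENSUS of connectedness / one-particle-irreducibility / properness over the drawn self-energy and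
three-leg pictures of the tree (p18's model graphs), decided by the kernel, with three non-examples showing the notions bite

statement-level skeleton of published theorems with citation tags; proofs where landed; nothing here is a claim about
the Yang–Mills mass gap

PDF held: `paper:balaban1983-higgs-2-3-quantum-fields-finite-volume` (journal page = PDF page + 410); pp. 417, 429–430, 438–439
read in the text layer (`p0007.txt`, `p0019.txt`, `p0020.txt`, `p0028.txt` of `lit read`) and on the ×2 renders
`run/shared/lean/pub/pub-balaban/b2b-balaban-ref1/pages/1983-cmp88-higgs23-III/1983-cmp88-higgs23-III-p019, p020, p028,
p029-x2.png` (the pictures are drawings; their reading as graphs of the model is p18's, module docstrings of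
`B3Sect2ThreeLegGraphs`, `B3Sect3Graphs318`, `B3Sect3LowestOrderGraphs`, `B3Sect1Graphs122`).

CITATION HEADER (lean-in-tree rule).  lit-balaban TYPED SKELETON (HOME `run/shared/lean/pub/lit-balaban/`), PHASE 2, seat p37
gen 105 (unit `lit-balaban-p37`; TAKING line HOME/STATUS.md 2026-08-23T08:13:46Z; owner r15 g15 08:14:29Z: «WELCOME … please
decide (2.18)–(2.22)'s pictures too if it is one `decide` each»).  Sibling of `B3OnePIGraphs` (the predicates `IsConnected` /
`IsOnePI` / `IsProper` and their structure-literal deciders).  LOCATED MEMBER, cells only, zero head weight, for the rows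
**B3.Txt@430** (p. 430 «1PI graphs only», lead Q15 disclosure «1PI not modelled»), **B3.Eq3.18-3.20**, **B3.Eq3.21-3.24**
(+ GAPS G-B3-05), **B3.Eq3.25-3.32**, **B3.Eq1.23**, **B3.Eq2.18-2.22** (+ GAPS G-B3-03) of `HOME/lit-balaban-r15/ROWS-B3.md`
(fold owner r15).  REUSED BY NAME, nothing re-declared: p18's drawn graphs `B3Sect3Graphs318.g318c/d/e/f`,
`B3Sect3LowestOrderGraphs.g321a/g321b/g321Y/g325a/g325b/g325c/g325d`, `B3Sect1Graphs122.g123g/g123h/g123i`,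
`B3Sect2ThreeLegGraphs.g218/g219/g220/g221a/g221b/g221c/g221d/g221e/g221f/gX1/gX2`.

THE PRINTED TEXT (verbatim).  p. 430: *"The next class of graphs is formed by graphs with two external scalar field legs. The
estimate (2.17) implies that we can have such graphs with at most four vertices. We consider one-particle-irreducible graphs only.
… There is a similar class of graphs with two external vector field legs"*; p. 417: *"Σ^ε_G, the summation over a family of
one-particle-irreducible graphs with two external legs of scalar fields"*; p. 438: *"Primitively divergent graphs, i.e. the graphs
(3.18)"*, *"We have to consider another class of graphs with two external scalar field legs, the graphs with one leg
differentiated. There are only two such graphs: (3.21)"*; pp. 429–430: *"graphs with two external legs of scalar fields and one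
external vector field leg … each pair of graphs below form one class: (2.18) (2.19) (2.20) … In fact the only other divergent
graphs of this class are: (a) (b) (c) [(d) (e) (f) (g)] (2.21) and permuted graphs"* (no 1PI restriction printed for this class).

WHAT IS PROVED (kernel theorems by `decide` through `B3OnePIGraphs.isOnePI_mk` etc.; `def`s = one membership predicate and the
non-examples' line data; no `Prop` fact, no `sorry`; standard axioms).
§0 `IsSelfEnergyGraph G` = p. 417's *"one-particle-irreducible graphs with two external legs of scalar fields"* (1PI + p18's leg
counts) with `pictures122_isSelfEnergyGraph` (the seven pictures of (1.22) are members).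
§1 TWO-LEG SELF-ENERGY PICTURES (all 1PI except one): (3.18)③④⑤⑥ `isOnePI_g318c/d/e/f` (①②⑦ = (1.22)⑤③⑥ in the sibling);
(3.21)①② `isOnePI_g321a/b`; **`not_isOnePI_g321Y`** with `isProper_g321Y` — the THIRD degree-0 graph of the (3.21) class on the
model (GAPS G-B3-05) is connected and proper but NOT 1PI (its φ′-tadpole hangs by the A′-line): a kernel fact OFFERED to
G-B3-05 — under p. 430's 1PI restriction read in the strong sense the printed «only two such graphs» is exact on the model (no
adjudication here); (1.23)⑦⑧⑨ attached `isOnePI_g123g/h/i`; (3.25) `isOnePI_g325`.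
§2 THE THREE-LEG CLASS (2.18)–(2.21) + X1, X2: `threeLeg_onePI_census` — 1PI = (2.18), (2.19), (2.20), X1; (2.21a) proper, not 1PI
(`not_isOnePI_g221a`, `isProper_g221a`; p. 442: its expression vanishes); (2.21b)–(2.21f), X2 NOT proper (`not_isProper_g221bc`,
`not_isProper_g221def`, `not_isProper_gX2`: the Ã-vertex (1.8)_{0,1} is attached by ONE φ′-line, which separates the two external
scalar legs); all eleven connected (`isConnected_threeLeg`).  Print imposes no 1PI restriction on this class — recorded, not a gap.
§3 NON-EXAMPLES (graphs of the model with vertices from the (1.21) catalogue): `chain77` = •δm²——•δm² (two vertices (1.7) joined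
by one φ′-line — the reducible chain C₀(−δm²)C₀(−δm²)C₀ that the n = 2 term of (1.21) generates from the LETTER −δm²; the bare
vertex (1.7) is not a graph: p. 415 *"at least one internal line"*): connected, NEITHER 1PI NOR proper; `hang18` (a φ′-loop at a
vertex (1.8)_{1,0} hanging by the A′-line from the vertex (1.8)_{1,0} carrying both external legs): proper, NOT 1PI; `tadpoles2`
(two φ′-tadpoles at two vertices (1.6) side by side): NOT connected — p. 415's "connected" is a genuine restriction on the carrier.
HONEST SCOPE.  Decisions on drawn pictures only; no enumeration claim for any class; nothing analytic.
-/

namespace Literature.MathematicalPhysics.QuantumFieldTheory.Balaban1983to89.B3OnePIPictureCensus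

open Relation B3Prop1 B3Cor23Concrete B3DivergentGraphs B3Sect3LowestOrderGraphs B3Sect3Graphs318 B3Sect1Graphs122
  B3Sect2ThreeLegGraphs B3OnePIGraphs

variable {nbar : ℕ}

/-! ## §0 The index family of p. 417: 1PI graphs with two external scalar legs -/

section SelfEnergyFamily

/-- **p. 417 [PDF 7], verbatim: *"A term e^αλ^βΣ^ε_{(α,β)} can be written also as a sum of terms Σ^ε_G, the summation over a family
of one-particle-irreducible graphs with two external legs of scalar fields."*** — membership in that family, on the model: `G` is
1PI (`B3OnePIGraphs.IsOnePI`) with exactly two external φ′-legs, no external A′-leg, no Ã-leg and no differentiation on an external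
leg (p18's counts `B3DivergentGraphs.numExtScalarLegs` / `numExtVectorLegs` / `numTildeLegs` / `numExtDiffs`; the graphs of Σ₁^ε,
Σ₂^ε of (1.21) differ by one, resp. two external differentiations). [cite: Balaban1983Higgs3, (1.23) p.417] -/
def IsSelfEnergyGraph (G : Graph nbar) : Prop :=
  IsOnePI G ∧ (numExtScalarLegs G = 2 ∧ numExtVectorLegs G = 0 ∧ numTildeLegs G = 0 ∧ numExtDiffs G = 0)

/-- kernel: the seven pictures ①–⑦ of (1.22) are members of p. 417's family (1PI by `B3OnePIGraphs.pictures122_isOnePI`, leg counts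
by p18's `g36_legs`, `g318_legs`, `newGraphs_legs`). [cite: Balaban1983Higgs3, (1.22) p.416] -/
theorem pictures122_isSelfEnergyGraph (hn : 1 ≤ nbar) (hn2 : 2 ≤ nbar) (hn4 : 4 ≤ nbar) :
    IsSelfEnergyGraph (g36c nbar) ∧ IsSelfEnergyGraph (g36b nbar hn2) ∧ IsSelfEnergyGraph (g318b nbar hn4) ∧
      IsSelfEnergyGraph (g36a nbar hn) ∧ IsSelfEnergyGraph (g318a nbar hn2) ∧ IsSelfEnergyGraph (g318g nbar) ∧
      IsSelfEnergyGraph (g122g nbar hn) := by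
  have hn3 : 3 ≤ nbar := le_trans (by decide) hn4
  obtain ⟨h1, h2, h3, h4, h5, h6, h7⟩ := pictures122_isOnePI hn hn2 hn4
  have l36 := g36_legs hn hn2
  have l318 := g318_legs hn2 hn3 hn4
  have l122 := newGraphs_legs hn hn2 (g122g nbar hn) (by simp)
  exact ⟨⟨h1, l36.2.2⟩, ⟨h2, l36.2.1⟩, ⟨h3, l318.2.1⟩, ⟨h4, l36.1⟩, ⟨h5, l318.1⟩, ⟨h6, l318.2.2.2.2.2.2⟩, ⟨h7, l122⟩⟩

end SelfEnergyFamily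

/-! ## §1 The drawn two-leg self-energy pictures of the tree, decided

p. 430 [PDF 20], verbatim, on the class with two external scalar legs: *"We consider one-particle-irreducible graphs only."*;
p. 417 [PDF 7]: *"Σ^ε_G, the summation over a family of one-particle-irreducible graphs with two external legs of scalar fields"*;
p. 438 [PDF 28]: *"Primitively divergent graphs, i.e. the graphs (3.18)"* and *"There are only two such graphs: (3.21)"*. -/

section MorePictures

/-- (3.18)③ p. 438 (p18's `g318c`: (1.8)_{2,0}–(1.10)_{2,0}, φ′-line + both A′-lines) is 1PI. [cite: Balaban1983Higgs3, (3.18) p.438] -/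
theorem isOnePI_g318c (hn2 : 2 ≤ nbar) : IsOnePI (g318c nbar hn2) :=
  isOnePI_mk (n := 1) (by decide)

/-- (3.18)④ p. 438 (p18's `g318d`: two (1.8)_{2,0}, φ′-line + both A′-lines) is 1PI. [cite: Balaban1983Higgs3, (3.18) p.438] -/
theorem isOnePI_g318d (hn2 : 2 ≤ nbar) : IsOnePI (g318d nbar hn2) :=
  isOnePI_mk (n := 1) (by decide)

/-- (3.18)⑤ AS PRINTED p. 438 (p18's `g318e`, the catalogue reading of the picture with the missing arrowhead, GAPS G-B3-06) is
1PI. [cite: Balaban1983Higgs3, (3.18) p.438] -/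
theorem isOnePI_g318e (hn3 : 3 ≤ nbar) : IsOnePI (g318e nbar hn3) :=
  isOnePI_mk (n := 1) (by decide)

/-- (3.18)⑥ p. 438 (p18's `g318f`: (1.8)_{3,0} with an A′-tadpole, A′-line and φ′-line to (1.8)_{1,0}) is 1PI — the tadpole sits
AT a vertex of the channel, no cut detaches it. [cite: Balaban1983Higgs3, (3.18) p.438] -/
theorem isOnePI_g318f (hn3 : 3 ≤ nbar) : IsOnePI (g318f nbar hn3) :=
  isOnePI_mk (n := 1) (by decide)

/-- (3.21)① p. 438 (p18's `g321a`, one vertex) is 1PI. [cite: Balaban1983Higgs3, (3.21) p.438] -/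
theorem isOnePI_g321a (hn2 : 2 ≤ nbar) : IsOnePI (g321a nbar hn2) :=
  isOnePI_of_nV_eq_one rfl

/-- (3.21)② p. 438 (p18's `g321b`: two (1.8)_{1,0}, A′-line + one φ′-line) is 1PI. [cite: Balaban1983Higgs3, (3.21) p.438] -/
theorem isOnePI_g321b (hn : 1 ≤ nbar) : IsOnePI (g321b nbar hn) :=
  isOnePI_mk (n := 1) (by decide)

/-- **the third degree-0 graph of the (3.21) class on the model, p18's `g321Y` (GAPS G-B3-05: a φ′-tadpole at one vertex (1.8)_{1,0}
hanging by the A′-line from the vertex carrying both external legs), is NOT one-particle-irreducible**: cutting the A′-line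
detaches the tadpole.  Kernel fact offered to G-B3-05 (not an adjudication): under p. 430's *"We consider one-particle-irreducible
graphs only"* read in the strong sense, the printed *"There are only two such graphs: (3.21)"* is exact on the model — of the three
degree-0 graphs (`B3Sect3ScalarSEDegrees`), exactly (3.21)①② are 1PI. [cite: Balaban1983Higgs3, (3.21) p.438] -/
theorem not_isOnePI_g321Y (hn : 1 ≤ nbar) : ¬ IsOnePI (g321Y nbar hn) :=
  not_isOnePI_mk (by decide)

/-- kernel: `g321Y` is nevertheless connected and proper (both external legs at one vertex) — it is reducible only in the strong
sense. [cite: Balaban1983Higgs3, (3.21) p.438] -/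
theorem isProper_g321Y (hn : 1 ≤ nbar) : IsProper (g321Y nbar hn) :=
  isProper_mk (n := 1) (by decide)

/-- (1.23)⑦ p. 417 in the attached form (p18's `g123g`: ④ with the graph ① on its φ-line) is 1PI. [cite: Balaban1983Higgs3, (1.23) p.417] -/
theorem isOnePI_g123g (hn : 1 ≤ nbar) : IsOnePI (g123g nbar hn) :=
  isOnePI_mk (n := 2) (by decide)

/-- (1.23)⑧ p. 417 in the attached form (p18's `g123h`: ④ with the graph ② on its φ-line) is 1PI. [cite: Balaban1983Higgs3, (1.23) p.417] -/
theorem isOnePI_g123h (hn2 : 2 ≤ nbar) : IsOnePI (g123h nbar hn2) :=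
  isOnePI_mk (n := 2) (by decide)

/-- (1.23)⑨ p. 417 in the attached form (p18's `g123i`: ④ with a copy of ④ on its φ-line, four vertices) is 1PI.
[cite: Balaban1983Higgs3, (1.23) p.417] -/
theorem isOnePI_g123i (hn : 1 ≤ nbar) : IsOnePI (g123i nbar hn) :=
  isOnePI_mk (n := 3) (by decide)

/-- (3.25) p. 439, the four vector self-energy pictures (p18's `g325a`–`g325d`; the class of p. 430 *"with two external vector field
legs"*) are 1PI. [cite: Balaban1983Higgs3, (3.25) p.439] -/
theorem isOnePI_g325 (hn : 1 ≤ nbar) (hn2 : 2 ≤ nbar) :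
    IsOnePI (g325a nbar hn) ∧ IsOnePI (g325b nbar hn) ∧ IsOnePI (g325c nbar hn2) ∧ IsOnePI (g325d nbar hn2) :=
  ⟨isOnePI_mk (n := 1) (by decide), isOnePI_mk (n := 1) (by decide), isOnePI_of_nV_eq_one rfl, isOnePI_of_nV_eq_one rfl⟩

end MorePictures

/-! ## §2 The three-leg class (2.18)–(2.21) pp. 429–430 and G-B3-03's X1, X2, decided

Print does not restrict this class to 1PI graphs (the 1PI sentence of p. 430 opens the NEXT class).  On the model the eleven drawn
graphs of p18's `B3Sect2ThreeLegGraphs` split as: 1PI = (2.18), (2.19), (2.20), X1; proper but not 1PI = (2.21a) (a φ′-tadpole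
hanging by the A′-line); connected but not proper = (2.21b), (2.21c), (2.21d), (2.21e), (2.21f), X2 (the Ã-vertex (1.8)_{0,1} is
attached to a self-energy part by a single φ′-line, which separates the two external scalar legs). -/

section ThreeLeg

/-- (2.18) p. 429 (p18's `g218`) is 1PI. [cite: Balaban1983Higgs3, (2.18) p.429] -/
theorem isOnePI_g218 (hn : 1 ≤ nbar) : IsOnePI (g218 nbar hn) :=
  isOnePI_mk (n := 1) (by decide)

/-- (2.19) p. 429 (p18's `g219`) is 1PI. [cite: Balaban1983Higgs3, (2.19) p.429] -/
theorem isOnePI_g219 (hn : 1 ≤ nbar) : IsOnePI (g219 nbar hn) :=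
  isOnePI_mk (n := 1) (by decide)

/-- (2.20) p. 429 (p18's `g220`, the triangle) is 1PI. [cite: Balaban1983Higgs3, (2.20) p.429] -/
theorem isOnePI_g220 (hn : 1 ≤ nbar) : IsOnePI (g220 nbar hn) :=
  isOnePI_mk (n := 2) (by decide)

/-- X1 of GAPS G-B3-03 (p18's `gX1`: (1.8)_{0,1} doubly φ′-linked to (1.6)) is 1PI. [cite: Balaban1983Higgs3, (2.21) p.430] -/
theorem isOnePI_gX1 (hn : 1 ≤ nbar) : IsOnePI (gX1 nbar hn) :=
  isOnePI_mk (n := 1) (by decide)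

/-- (2.21a) p. 430 (p18's `g221a`: a φ′-tadpole at (1.8)_{1,0} hanging by the A′-line from (1.10)_{1,1}) is NOT 1PI — cutting the
A′-line detaches the tadpole (cf. p. 442: *"the expression corresponding to the graph (2.21a) vanishes"*).
[cite: Balaban1983Higgs3, (2.21) p.430] -/
theorem not_isOnePI_g221a (hn : 1 ≤ nbar) : ¬ IsOnePI (g221a nbar hn) :=
  not_isOnePI_mk (by decide)

/-- kernel: (2.21a) is connected and proper (all its external legs at one vertex). [cite: Balaban1983Higgs3, (2.21) p.430] -/
theorem isProper_g221a (hn : 1 ≤ nbar) : IsProper (g221a nbar hn) :=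
  isProper_mk (n := 1) (by decide)

/-- (2.21b), (2.21c) p. 430 (p18's `g221b`, `g221c`) are NOT proper: the single φ′-line from the Ã-vertex (1.8)_{0,1} separates the
two external scalar legs (a chain «Ã-vertex —— graph ④»). [cite: Balaban1983Higgs3, (2.21) p.430] -/
theorem not_isProper_g221bc (hn : 1 ≤ nbar) : ¬ IsProper (g221b nbar hn) ∧ ¬ IsProper (g221c nbar hn) :=
  ⟨not_isProper_mk (by decide), not_isProper_mk (by decide)⟩

/-- (2.21d), (2.21e), (2.21f) p. 430 (p18's `g221d`, `g221e`, `g221f`) are NOT proper: the φ′-line from the Ã-vertex to the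
tadpole-carrying vertex separates the two external scalar legs. [cite: Balaban1983Higgs3, (2.21) p.430] -/
theorem not_isProper_g221def (hn : 1 ≤ nbar) (hn2 : 2 ≤ nbar) :
    ¬ IsProper (g221d nbar hn2) ∧ ¬ IsProper (g221e nbar hn2) ∧ ¬ IsProper (g221f nbar hn) :=
  ⟨not_isProper_mk (by decide), not_isProper_mk (by decide), not_isProper_mk (by decide)⟩

/-- X2 of GAPS G-B3-03 (p18's `gX2`) is NOT proper (and its tadpole vertex is detached by cutting the A′-line).
[cite: Balaban1983Higgs3, (2.21) p.430] -/
theorem not_isProper_gX2 (hn : 1 ≤ nbar) : ¬ IsProper (gX2 nbar hn) ∧ ¬ IsOnePI (gX2 nbar hn) :=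
  ⟨not_isProper_mk (by decide), not_isOnePI_mk (by decide)⟩

/-- kernel: all eleven three-leg graphs are CONNECTED graphs in the sense of p. 415. [cite: Balaban1983Higgs3, p.415] -/
theorem isConnected_threeLeg (hn : 1 ≤ nbar) (hn2 : 2 ≤ nbar) :
    IsConnected (g218 nbar hn) ∧ IsConnected (g219 nbar hn) ∧ IsConnected (g220 nbar hn) ∧ IsConnected (g221a nbar hn) ∧
      IsConnected (g221b nbar hn) ∧ IsConnected (g221c nbar hn) ∧ IsConnected (g221d nbar hn2) ∧ IsConnected (g221e nbar hn2) ∧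
      IsConnected (g221f nbar hn) ∧ IsConnected (gX1 nbar hn) ∧ IsConnected (gX2 nbar hn) :=
  ⟨isConnected_mk (n := 1) (by decide), isConnected_mk (n := 1) (by decide), isConnected_mk (n := 2) (by decide),
    isConnected_mk (n := 1) (by decide), isConnected_mk (n := 2) (by decide), isConnected_mk (n := 2) (by decide),
    isConnected_mk (n := 1) (by decide), isConnected_mk (n := 1) (by decide), isConnected_mk (n := 1) (by decide),
    isConnected_mk (n := 1) (by decide), isConnected_mk (n := 2) (by decide)⟩

/-- kernel: the 1PI members of the drawn three-leg graphs are exactly (2.18), (2.19), (2.20) and X1 — the other seven are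
reducible. [cite: Balaban1983Higgs3, (2.21) p.430] -/
theorem threeLeg_onePI_census (hn : 1 ≤ nbar) (hn2 : 2 ≤ nbar) :
    (IsOnePI (g218 nbar hn) ∧ IsOnePI (g219 nbar hn) ∧ IsOnePI (g220 nbar hn) ∧ IsOnePI (gX1 nbar hn)) ∧
    (¬ IsOnePI (g221a nbar hn) ∧ ¬ IsOnePI (g221b nbar hn) ∧ ¬ IsOnePI (g221c nbar hn) ∧ ¬ IsOnePI (g221d nbar hn2) ∧
      ¬ IsOnePI (g221e nbar hn2) ∧ ¬ IsOnePI (g221f nbar hn) ∧ ¬ IsOnePI (gX2 nbar hn)) :=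
  ⟨⟨isOnePI_g218 hn, isOnePI_g219 hn, isOnePI_g220 hn, isOnePI_gX1 hn⟩,
    ⟨not_isOnePI_g221a hn, not_isOnePI_of_not_isProper (not_isProper_g221bc hn).1,
      not_isOnePI_of_not_isProper (not_isProper_g221bc hn).2, not_isOnePI_of_not_isProper (not_isProper_g221def hn hn2).1,
      not_isOnePI_of_not_isProper (not_isProper_g221def hn hn2).2.1,
      not_isOnePI_of_not_isProper (not_isProper_g221def hn hn2).2.2, (not_isProper_gX2 hn).2⟩⟩

end ThreeLeg

/-! ## §3 The notions bite: a reducible chain, a hanging tadpole, a disconnected graph -/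

section NonExamples

/-- The vertices of the two-insertion chain: two mass-renormalization vertices (1.7). [cite: Balaban1983Higgs3, (1.21) p.416] -/
def chain77Kind : Fin 2 → VertexKind := fun _ => .v17

/-- The line data of the two-insertion chain: one φ′-line from leg 0 of vertex 0 to leg 0 of vertex 1; leg 1 of each vertex
external. [cite: Balaban1983Higgs3, (1.21) p.416] -/
def chain77Other : Leg chain77Kind → Option (Leg chain77Kind)
  | ⟨i, .inl j⟩ => if j.val = 0 then some ⟨i.rev, .inl ⟨0, (by decide : (0 : ℕ) < 2)⟩⟩ else none
  | ⟨_, .inr j⟩ => j.elim0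

/-- The TWO-INSERTION CHAIN •δm²——•δm²: two mass-renormalization vertices (1.7) joined by one φ′-line, the other φ′-leg of each
vertex external.  A graph of the model (one internal line); its expression C₀^ε(−δm²)C₀^ε(−δm²)C₀^ε (with the external
propagators) is the n = 2 term of (1.21) built from the LETTER −δm² of the insertion — a reducible chain, not a term of Σ^ε.  (The
bare vertex (1.7) alone is not a graph: p. 415 *"There is at least one internal line"*, p18's `Graph.exists_line`.)
[cite: Balaban1983Higgs3, (1.21) p.416] -/
def chain77 (nbar : ℕ) : Graph nbar where
  nV := 2
  kind := chain77Kind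
  adm _ := trivial
  other := chain77Other
  other_ne := by decide
  other_symm := by decide
  other_isLeft := by decide
  exists_line := by decide

/-- The leg 0 of vertex 0 of the chain (an endpoint of its one line). [cite: Balaban1983Higgs3, (1.21) p.416] -/
def chain77Leg0 : Leg chain77Kind := ⟨0, .inl ⟨0, by decide⟩⟩

/-- The two external legs of the chain: leg 1 of vertex 0 and leg 1 of vertex 1. [cite: Balaban1983Higgs3, (1.21) p.416] -/
def chain77Ext (i : Fin 2) : Leg chain77Kind := ⟨i, .inl ⟨1, (by decide : (1 : ℕ) < 2)⟩⟩

/-- kernel: the chain •δm²——•δm² is connected. [cite: Balaban1983Higgs3, p.415] -/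
theorem isConnected_chain77 : IsConnected (chain77 nbar) :=
  isConnected_mk (n := 1) (by decide)

/-- kernel: cutting its one line disconnects the chain — it is NOT connected off that line (the vertex set {0} is closed under
the remaining adjacency and misses the vertex 1). [cite: Balaban1983Higgs3, (1.21) p.416] -/
theorem not_isConnectedOff_chain77 : ¬ IsConnectedOff (chain77 nbar) chain77Leg0 := by
  have key : sepWitnessB (AdjOffOf chain77Other chain77Leg0) (fun a => decide (a = 0)) ⟨0, by decide⟩ ⟨1, by decide⟩
      = true := by
    decide
  exact fun h => not_reflTransGen_of_sepWitnessB key (h _ _)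

/-- **the chain •δm²——•δm² is one-particle REDUCIBLE** (connected, but its φ′-line is a cut line) — the kind of graph (1.21)
resums rather than lists in Σ^ε. [cite: Balaban1983Higgs3, (1.21) p.416] -/
theorem not_isOnePI_chain77 : ¬ IsOnePI (chain77 nbar) := by
  have hc : (chain77Other chain77Leg0).isSome = true := by decide
  exact fun h => not_isConnectedOff_chain77 (h.2 chain77Leg0 hc)

/-- kernel: the chain is not even proper — its line separates the two external legs (leg 1 of vertex 0 from leg 1 of
vertex 1). [cite: Balaban1983Higgs3, (1.21) p.416] -/
theorem not_isProper_chain77 : ¬ IsProper (chain77 nbar) := by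
  have key : sepWitnessB (AdjOffOf chain77Other chain77Leg0) (fun a => decide (a = 0)) ⟨0, by decide⟩ ⟨1, by decide⟩
      = true := by
    decide
  have hc : (chain77Other chain77Leg0).isSome = true := by decide
  have e₀ : chain77Other (chain77Ext 0) = none := by decide
  have e₁ : chain77Other (chain77Ext 1) = none := by decide
  exact fun h => not_reflTransGen_of_sepWitnessB key (h.2 chain77Leg0 hc (chain77Ext 0) (chain77Ext 1) e₀ e₁)

/-- The vertices of the hanging tadpole: two vertices (1.8)_{1,0} (in the (1.21) catalogue: (1.8) with n′ = 0).
[cite: Balaban1983Higgs3, (1.21) p.416] -/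
def hang18Kind : Fin 2 → VertexKind := fun _ => .v18 1 0

/-- The line data of the hanging tadpole: both φ′-legs of vertex 0 external; the φ′-legs of vertex 1 joined to each other (a
φ′-loop through its differentiation); the A′-legs of the two vertices joined. [cite: Balaban1983Higgs3, (1.21) p.416] -/
def hang18Other : Leg hang18Kind → Option (Leg hang18Kind)
  | ⟨i, .inl j⟩ =>
      if i.val = 0 then none
      else some ⟨i, .inl ⟨1 - j.val, lt_of_le_of_lt (Nat.sub_le 1 j.val) (by decide : (1 : ℕ) < 2)⟩⟩
  | ⟨i, .inr _⟩ => some ⟨i.rev, .inr ⟨0, (by decide : (0 : ℕ) < 1)⟩⟩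

/-- The HANGING TADPOLE `hang18`: the vertex 0 = (1.8)_{1,0} carries both external φ′-legs; its A′-leg is joined to the A′-leg of
the vertex 1 = (1.8)_{1,0}, whose two φ′-legs close a loop.  A graph of the model for n̄ ≥ 1. [cite: Balaban1983Higgs3, (1.21) p.416] -/
def hang18 (nbar : ℕ) (hn : 1 ≤ nbar) : Graph nbar where
  nV := 2
  kind := hang18Kind
  adm _ := by simp [hang18Kind, VertexKind.Admissible, hn]
  other := hang18Other
  other_ne := by decide
  other_symm := by decide
  other_isLeft := by decide
  exists_line := by decide

/-- The A′-leg of vertex 0 of the hanging tadpole (an endpoint of its A′-line). [cite: Balaban1983Higgs3, (1.21) p.416] -/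
def hang18LegA : Leg hang18Kind := ⟨0, .inr ⟨0, by decide⟩⟩

/-- kernel: the hanging tadpole is connected and PROPER (both external legs sit at the vertex 0; no cut separates them).
[cite: Balaban1983Higgs3, (1.21) p.416] -/
theorem isProper_hang18 (hn : 1 ≤ nbar) : IsProper (hang18 nbar hn) :=
  isProper_mk (n := 1) (by decide)

/-- **the hanging tadpole is NOT one-particle-irreducible**: cutting its A′-line detaches the loop at the vertex 1 — the two
variants of "1PI" differ exactly on such graphs. [cite: Balaban1983Higgs3, (1.21) p.416] -/
theorem not_isOnePI_hang18 (hn : 1 ≤ nbar) : ¬ IsOnePI (hang18 nbar hn) := by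
  have key : sepWitnessB (AdjOffOf hang18Other hang18LegA) (fun a => decide (a = 0)) ⟨0, by decide⟩ ⟨1, by decide⟩
      = true := by
    decide
  have hc : (hang18Other hang18LegA).isSome = true := by decide
  exact fun h => not_reflTransGen_of_sepWitnessB key (h.2 hang18LegA hc _ _)

/-- The vertices of the two tadpoles: two vertices (1.6). [cite: Balaban1983Higgs3, p.415] -/
def tadpoles2Kind : Fin 2 → VertexKind := fun _ => .v16

/-- The line data of the two tadpoles: at each vertex the φ′-legs 0 and 1 are joined into a loop, the legs 2 and 3 external; no
line between the vertices. [cite: Balaban1983Higgs3, p.415] -/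
def tadpoles2Other : Leg tadpoles2Kind → Option (Leg tadpoles2Kind)
  | ⟨i, .inl j⟩ =>
      if j.val = 0 then some ⟨i, .inl ⟨1, (by decide : (1 : ℕ) < 4)⟩⟩
      else if j.val = 1 then some ⟨i, .inl ⟨0, (by decide : (0 : ℕ) < 4)⟩⟩ else none
  | ⟨_, .inr j⟩ => j.elim0

/-- TWO TADPOLES SIDE BY SIDE `tadpoles2`: two vertices (1.6), each with two of its φ′-legs joined into a loop and the other two
external; no line between the two vertices.  A graph of the model (two internal lines). [cite: Balaban1983Higgs3, p.415] -/
def tadpoles2 (nbar : ℕ) : Graph nbar where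
  nV := 2
  kind := tadpoles2Kind
  adm _ := trivial
  other := tadpoles2Other
  other_ne := by decide
  other_symm := by decide
  other_isLeft := by decide
  exists_line := by decide

/-- **`tadpoles2` is NOT connected** — p. 415's *"connected in the usual sense"* is a genuine restriction on the carrier (the
vertex set {0} is closed under adjacency and misses the vertex 1). [cite: Balaban1983Higgs3, p.415] -/
theorem not_isConnected_tadpoles2 : ¬ IsConnected (tadpoles2 nbar) := by
  have key : sepWitnessB (AdjOf tadpoles2Other) (fun a => decide (a = 0)) ⟨0, by decide⟩ ⟨1, by decide⟩ = true := by
    decide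
  exact fun h => not_reflTransGen_of_sepWitnessB key (h _ _)

/-- kernel: hence `tadpoles2` is neither 1PI nor proper. [cite: Balaban1983Higgs3, (1.21) p.416] -/
theorem not_isOnePI_tadpoles2 : ¬ IsOnePI (tadpoles2 nbar) ∧ ¬ IsProper (tadpoles2 nbar) :=
  ⟨fun h => not_isConnected_tadpoles2 h.1, fun h => not_isConnected_tadpoles2 h.1⟩

end NonExamples

end Literature.MathematicalPhysics.QuantumFieldTheory.Balaban1983to89.B3OnePIPictureCensus
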